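import Summits.QuantumFields.YangMills.Theorems.AlphaInputsT3ACv3Step
import Summits.QuantumFields.YangMills.Theorems.AlphaInputsT3ACv2RecZterm
import HarnessLib

/-!
# `AlphaInputsT3ACv3Ready` — v5p4's STUB 2‴ `stub_windowedWeights` (crux `HistoryTailL` = stmt-QuantumFields-19936) FOR THE CONCRETE v2 DATUM, CONDITIONAL
# ON THE PROPOSED v3 RESIDUAL ROWS: the T³ reading of `AlphaInputsT3ACv3Step` — lane `pub-balaban3d`, seat alpha-1 (g3)

WHAT THIS FILE IS.  The windowed pinned weights of `PinnedStep` read at the package's data of run `K` (`OfV2At.pkgAtV2`), with the window of level `k + 1`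
of history `h′` := print's (40) window of the concrete datum's `Adm = ChargedT3` (all level-`(k+1)` plaquettes under `Ω_{k+1}(h′)` within
`2L²·avgWindowFactor(L)·θBal(K − k)` of `1`): `wt′ K j r := OfV2At.wtPT3`.  UNDER the hypothesis schema `OfV2At.Fibre55WinRows` (the proposed v3 residual
`PinnedStep.Fibre55WinAC` at every step `k < K` of run `K` and every new history, read at the package's data — NOT part of the v2 package, never asserted) the six
clauses of v5p4's `stub_windowedWeights` hold with `wt′ := wtPT3` and `Bm := 1`, the support clause from `j = 1` (seat finding F-α1-9: at `j = 0` print has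
no characteristic function, (1) p.256) and POINTWISE: (w0) `wt′ ≥ 0`; (w1) `wt′ = 0` on inadmissible histories; (w2) `wt′ K j r W ≠ 0 ⇒ Adm K j r W` for
`1 ≤ j ≤ K`, EVERY history; (e′) `Integrable ∧ ∫ wt′ K j r ≤ 1`, uniformly in the cut-off; (e″) `Pint_j(r, ·)` measurable (`dataT3c_measurable_Pint`, from the
v2 rows alone); (iv) `Ineq41AE` and integrability of `up` for `dataT3c` with `LF` replaced by `Φ ↦ wt′(triv)e^{Φ triv} + Σ_{r ≠ triv} wt′(r)e^{Φ r}`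
(`PinnedStep.ineq41_pinned_windowed_ae` + `resDensity = e^{E}ρ` a.e.).  So an owner ruling «v3 := v2 ∧ Fibre55WinRows» closes 2‴ (with `1 ≤ j`) by name.
CONDITIONAL; nothing of [Balaban1985UV3] is asserted.

References: T. Bałaban, Commun. Math. Phys. 102 (1985) 255–275 [Balaban1985UV3] ((1) p.256, (40)–(41) p.266, (47) p.267, (55) p.269, Thm 2 p.272).
-/

set_option autoImplicit false

noncomputable section

namespace Summit.QuantumFields.YangMills.Theorems

open MeasureTheory
open Literature.MathematicalPhysics.QuantumFieldTheory.Balaban1983to89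
open Literature.MathematicalPhysics.QuantumFieldTheory.Balaban1983to89.T3ContinuumYM3Torus
open Literature.MathematicalPhysics.QuantumFieldTheory.Balaban1983to89.T3UnitLawDensityEML (ℰp)
open Literature.MathematicalPhysics.QuantumFieldTheory.Balaban1983to89.T3UnitScaleTilt (θBal)
open Literature.MathematicalPhysics.QuantumFieldTheory.Balaban1983to89.T3RestrictedUnitDensity (resDensity)
open Literature.MathematicalPhysics.QuantumFieldTheory.Balaban1983to89.T3AlphaInputsAC
open Literature.MathematicalPhysics.QuantumFieldTheory.Balaban1983to89.B10Eq38TorusDomains (plaqsIn)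
open Literature.MathematicalPhysics.QuantumFieldTheory.Balaban1985CMP102
open Literature.MathematicalPhysics.QuantumFieldTheory.Balaban1985CMP102.Setting
open Summit.QuantumFields.Balaban3D.Carriers
open Summit.QuantumFields.Balaban3D.Proofs.Primitives
open Summit.QuantumFields.Balaban3D.Proofs.TowerAC
open Summit.QuantumFields.Balaban3D.Proofs.StandardAC
open Summit.QuantumFields.Balaban3D.Proofs.InputsAC
open Summit.QuantumFields.Balaban3D.Proofs.MassesPAC
open Summit.QuantumFields.Balaban3D.Proofs.Thm2AC (stepResidualsAC_of_alpha)
open Summit.QuantumFields.Balaban3D.Proofs.TransportAC (integrable_mul_exp_of_le)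
open Summit.QuantumFields.Balaban3D.Proofs (Bound55Std.measurable_actionEta Bound55Std.actionEta_nonneg)

open Classical

variable {F : T3Family} {𝔠 : AlphaConsts F.L (suGroupModel 2).N} {a₀ a₁ : ℝ}

/-! ## §1 The window family of the concrete datum, the weights, the rows read at the package data -/

/-- **PRINT'S (40) WINDOW OF LEVEL `k + 1` FOR THE HISTORY `h′`** (the second conjunct of the datum's `Adm = ChargedT3` at level `k + 1`): all level-`(k+1)`
plaquettes under `Ω_{k+1}(h′)` within `2L²·avgWindowFactor(L)·θBal(K − k)` of `1`. [cite: Balaban1985UV3, (40) p.266] -/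
def AlphaInputsT3AC.admWindowT3 (F : T3Family) (𝔠 : AlphaConsts F.L (suGroupModel 2).N) (γ : ℝ) (hγ : 0 < γ)
    (hγ1 : γ ≤ (min 𝔠.gamma0 1) ^ 2) (K k : ℕ) (h' : Hist (F.P K) (k + 1)) :
    Set (GaugeField (F.P K) (k + 1) (Matrix.specialUnitaryGroup (Fin 2) ℂ)) :=
  {W | PlaqSmallOn (↑(plaqsIn (k + 1) (Omega 𝔠.lane.carrier.M₁
      (rcolOf (T3Scales F γ hγ (hγ1.trans (sq_min_one_le _ 𝔠.gamma0_pos)) K) 𝔠.lane.carrier) (k + 1) h' (k + 1))))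
    (2 * (F.L : ℝ) ^ 2 * avgWindowFactor F.L * θBal F.L γ 𝔠.b₀ 𝔠.p₀ (K - k)) W}

/-- The window is measurable. [folklore] -/
theorem AlphaInputsT3AC.measurableSet_admWindowT3 (F : T3Family) (𝔠 : AlphaConsts F.L (suGroupModel 2).N) (γ : ℝ) (hγ : 0 < γ)
    (hγ1 : γ ≤ (min 𝔠.gamma0 1) ^ 2) (K k : ℕ) (h' : Hist (F.P K) (k + 1)) :
    MeasurableSet (AlphaInputsT3AC.admWindowT3 F 𝔠 γ hγ hγ1 K k h') :=
  T4AxialGaugeFixing.measurableSet_plaqSmallOn _ _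

/-- **THE PROPOSED v3 RESIDUAL ROWS READ AT THE PACKAGE'S DATA** (hypothesis schema, never asserted; NOT part of the v2 package): at every run `K`, every
step `k < K` and every new history, `PinnedStep.Fibre55WinAC` for the package's inputs and expansion data with the (40) windows.
[cite: Balaban1985UV3, (55) p.269 + (58) p.270] -/
def AlphaInputsT3AC.OfV2At.Fibre55WinRows {F : T3Family} {𝔠 : AlphaConsts F.L (suGroupModel 2).N} {a₀ a₁ : ℝ}
    (h : AlphaInputsT3AC.OfV2At F 𝔠 a₀ a₁) (hc : 0 < a₀ ∧ 0 < a₁ ∧ 𝔠.B₃ * a₁ ≤ a₀) (γ : ℝ) (hγ : 0 < γ)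
    (hγ1 : γ ≤ (min 𝔠.gamma0 1) ^ 2) (K : ℕ) : Prop :=
  ∀ (k : ℕ), k + 1 ≤ K → ∀ h' : Hist (F.P K) (k + 1),
    PinnedStep.Fibre55WinAC 𝔠.lane (h.pkgAtV2 hc γ hγ hγ1 K).X (h.pkgAtV2 hc γ hγ hγ1 K).𝔖 (AlphaInputsT3AC.admWindowT3 F 𝔠 γ hγ hγ1 K) k h'


section Weights

variable (h : AlphaInputsT3AC.OfV2At F 𝔠 a₀ a₁) (hc : 0 < a₀ ∧ 0 < a₁ ∧ 𝔠.B₃ * a₁ ≤ a₀) (γ : ℝ) (hγ : 0 < γ)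
  (hγ1 : γ ≤ (min 𝔠.gamma0 1) ^ 2)

/-- **THE WINDOWED PINNED WEIGHTS OF RUN `K`** for the v2 datum: `PinnedStep.wtP` at the package's inputs with the (40) windows. [cite: Balaban1985UV3, (40)–(41) p.266] -/
def AlphaInputsT3AC.OfV2At.wtPT3 (K j : ℕ) (r : Hist (F.P K) j) : GaugeField (F.P K) j (Matrix.specialUnitaryGroup (Fin 2) ℂ) → ℝ :=
  PinnedStep.wtP 𝔠.lane (h.pkgAtV2 hc γ hγ hγ1 K).X (AlphaInputsT3AC.admWindowT3 F 𝔠 γ hγ hγ1 K) j r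

variable (π : AlphaInputsT3AC.PolymerT3 F)

/-! ## §2 The clauses -/

/-- (w0) `wt′ ≥ 0`. [folklore] -/
theorem AlphaInputsT3AC.OfV2At.wtPT3_nonneg (K j : ℕ) (r : Hist (F.P K) j) (W : GaugeField (F.P K) j (Matrix.specialUnitaryGroup (Fin 2) ℂ)) :
    0 ≤ h.wtPT3 hc γ hγ hγ1 K j r W :=
  (PinnedStep.wtP_nonneg_le 𝔠.lane (h.pkgAtV2 hc γ hγ hγ1 K).X (AlphaInputsT3AC.admWindowT3 F 𝔠 γ hγ hγ1 K) j r W).1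

/-- (w1) `wt′ = 0` on inadmissible histories. [folklore] -/
theorem AlphaInputsT3AC.OfV2At.wtPT3_eq_zero_of_not_admissible (K j : ℕ) (r : Hist (F.P K) j)
    (W : GaugeField (F.P K) j (Matrix.specialUnitaryGroup (Fin 2) ℂ))
    (hr : ¬ Hist.Admissible 𝔠.lane.carrier.M₁
      (rcolOf (T3Scales F γ hγ (hγ1.trans (sq_min_one_le _ 𝔠.gamma0_pos)) K) 𝔠.lane.carrier) j r) :
    h.wtPT3 hc γ hγ hγ1 K j r W = 0 :=
  PinnedStep.wtP_eq_zero_of_not_admissible 𝔠.lane (h.pkgAtV2 hc γ hγ hγ1 K).X (AlphaInputsT3AC.admWindowT3 F 𝔠 γ hγ hγ1 K) j r W hr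

/-- **(w2) SUPPORT IN `Adm`, EVERY HISTORY, `1 ≤ j ≤ K`, POINTWISE**: `wt′ K j r W ≠ 0 ⇒ Adm K j r W` for the concrete datum (`Adm = ChargedT3`: `r` admissible
and `W` in the (40) window under `Ω_j(r)`). [cite: Balaban1985UV3, (40)–(41) p.266] -/
theorem AlphaInputsT3AC.OfV2At.adm_of_wtPT3_ne_zero (K j : ℕ) (hj1 : 1 ≤ j) (hj : j ≤ K) (r : Hist (F.P K) j)
    (W : GaugeField (F.P K) j (Matrix.specialUnitaryGroup (Fin 2) ℂ)) (hW : h.wtPT3 hc γ hγ hγ1 K j r W ≠ 0) :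
    (h.dataT3c hc γ hγ hγ1 π).Adm K j r W := by
  obtain ⟨k, rfl⟩ : ∃ k, j = k + 1 := ⟨j - 1, by omega⟩
  obtain ⟨hmem, hadm⟩ := PinnedStep.mem_of_wtP_succ_ne_zero 𝔠.lane (h.pkgAtV2 hc γ hγ hγ1 K).X (AlphaInputsT3AC.admWindowT3 F 𝔠 γ hγ hγ1 K) k r W hW
  refine ⟨hadm, ?_⟩
  have hKk : K - (k + 1) + 1 = K - k := by omega
  rw [hKk]
  exact hmem

/-- (e′) `wt′ K j r` is integrable with `∫ ≤ 1`, uniformly in the cut-off. [folklore] -/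
theorem AlphaInputsT3AC.OfV2At.integrable_wtPT3_and_integral_le (K j : ℕ) (r : Hist (F.P K) j) :
    Integrable (h.wtPT3 hc γ hγ hγ1 K j r) (fieldMeasure (F.P K) j (Matrix.specialUnitaryGroup (Fin 2) ℂ)) ∧
      ∫ W, h.wtPT3 hc γ hγ hγ1 K j r W ∂fieldMeasure (F.P K) j (Matrix.specialUnitaryGroup (Fin 2) ℂ) ≤ 1 :=
  PinnedStep.integrable_wtP_and_integral_le 𝔠.lane (h.pkgAtV2 hc γ hγ hγ1 K).X (AlphaInputsT3AC.admWindowT3 F 𝔠 γ hγ hγ1 K) (AlphaInputsT3AC.measurableSet_admWindowT3 F 𝔠 γ hγ hγ1 K) j r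

/-- **THE DATUM WITH THE WINDOWED PINNED WEIGHTS** (structure update of `dataT3c`, as v5p4's STUB 2‴ writes it with `wt′ := wtPT3`). [cite: Balaban1985UV3, (41) p.266] -/
def AlphaInputsT3AC.OfV2At.dataT3cP : AlphaDataT3 F γ :=
  { h.dataT3c hc γ hγ hγ1 π with
    LF := fun K j Wf Φ => h.wtPT3 hc γ hγ hγ1 K j (Hist.triv (F.P K) j) Wf * Real.exp (Φ (Hist.triv (F.P K) j)) +
      ∑ r ∈ Finset.univ.erase (Hist.triv (F.P K) j), h.wtPT3 hc γ hγ hγ1 K j r Wf * Real.exp (Φ r) }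

/-- The majorant of `dataT3cP` is the full sum `Σ_h wt′(h)·e^{Φ′(h)}` (`Finset.add_sum_erase`). [folklore] -/
theorem AlphaInputsT3AC.OfV2At.dataT3cP_up_eq (K j : ℕ) (W : GaugeField (F.P K) j (Matrix.specialUnitaryGroup (Fin 2) ℂ)) :
    (h.dataT3cP hc γ hγ hγ1 π).up K j W =
      ∑ r : Hist (F.P K) j, h.wtPT3 hc γ hγ hγ1 K j r W *
        Real.exp (-((h.pkgAtV2 hc γ hγ hγ1 K).T.mainT j r W) + (h.pkgAtV2 hc γ hγ hγ1 K).T.Pint j r W + (h.pkgAtV2 hc γ hγ hγ1 K).T.Zterm j r) := by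
  rw [← Finset.add_sum_erase Finset.univ _ (Finset.mem_univ (Hist.triv (F.P K) j))]
  rfl

/-- **(iv) (41′) `dV`-a.e. for `dataT3cP`, every `j ≤ K`, GIVEN THE v3 ROWS.** [cite: Balaban1985UV3, (41) p.266 and Thm 2 p.272] -/
theorem AlphaInputsT3AC.OfV2At.dataT3cP_ineq41AE (K : ℕ) (hrows : h.Fibre55WinRows hc γ hγ hγ1 K) (j : ℕ) (hj : j ≤ K) :
    Ineq41AE (h.dataT3cP hc γ hγ hγ1 π) K j := by
  have hind := PinnedStep.ineq41_pinned_windowed_ae 𝔠.lane (h.pkgAtV2 hc γ hγ hγ1 K).X (h.pkgAtV2 hc γ hγ hγ1 K).𝔖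
    (AlphaInputsT3AC.admWindowT3 F 𝔠 γ hγ hγ1 K) (AlphaInputsT3AC.measurableSet_admWindowT3 F 𝔠 γ hγ hγ1 K)
    (fun k hk h' => hrows k hk h')
    (fun k hk => stepResidualsAC_of_alpha (T3Scales_window F 𝔠 γ hγ hγ1 K) k hk ((h.pkgAtV2 hc γ hγ hγ1 K).run.steps k hk))
    (fun k hk => ((h.pkgAtV2 hc γ hγ hγ1 K).run.steps k hk).hU)
    (fun k hk => ((h.pkgAtV2 hc γ hγ hγ1 K).run.steps k hk).hPm)
    (fun k hk => ⟨(h.pkgAtV2 hc γ hγ hγ1 K).𝔄.cP k, ((h.pkgAtV2 hc γ hγ hγ1 K).run.steps k hk).hPb⟩) j hj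
  have hres := (h.pkgAtV2 hc γ hγ hγ1 K).toPkgAt.resDensity_ae_eq j (by omega)
  have hE : Real.exp (-((h.dataT3cP hc γ hγ hγ1 π).Ecst K j) + (h.dataT3cP hc γ hγ hγ1 π).Rm K j) =
      Real.exp (h.pkgAtV2 hc γ hγ hγ1 K).E * Real.exp (-((h.pkgAtV2 hc γ hγ hγ1 K).T.Ecst j) + (h.pkgAtV2 hc γ hγ hγ1 K).T.Rm j) := by
    rw [← Real.exp_add]
    congr 1
    show -((h.pkgAtV2 hc γ hγ hγ1 K).T.Ecst j - (h.pkgAtV2 hc γ hγ hγ1 K).E) + (h.pkgAtV2 hc γ hγ hγ1 K).T.Rm j = _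
    ring
  have hsplit : ∀ (a b c d r : ℝ), Real.exp (-a + b - c + d + r) = Real.exp (-c + r) * Real.exp (-a + b + d) := fun a b c d r => by
    rw [← Real.exp_add]; congr 1; ring
  unfold Ineq41AE
  filter_upwards [hind, hres] with W hW hR
  rw [hR, hE, mul_assoc]
  refine mul_le_mul_of_nonneg_left ?_ (Real.exp_pos _).le
  simp only [hsplit] at hW
  refine hW.trans (le_of_eq ?_)
  rw [h.dataT3cP_up_eq hc γ hγ hγ1 π, Finset.mul_sum]
  exact Finset.sum_congr rfl fun r _ => by rw [mul_left_comm]; rfl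

/-- **(iv) integrability of `up_{dataT3cP}` given the data rows at level `j`.** [folklore] -/
theorem AlphaInputsT3AC.OfV2At.integrable_upP_of_rows (K j : ℕ)
    (hU : ∀ hh : Hist (F.P K) j, Measurable ((h.pkgAtV2 hc γ hγ hγ1 K).UkH j hh))
    (hPm : ∀ hh : Hist (F.P K) j, Measurable ((inputOfAC 𝔠.lane (h.pkgAtV2 hc γ hγ hγ1 K).X (h.pkgAtV2 hc γ hγ hγ1 K).𝔖).Pint j hh)) (cP : ℝ)
    (hPb : ∀ (hh : Hist (F.P K) j) (U : GaugeField (F.P K) j (Matrix.specialUnitaryGroup (Fin 2) ℂ)),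
      (inputOfAC 𝔠.lane (h.pkgAtV2 hc γ hγ hγ1 K).X (h.pkgAtV2 hc γ hγ hγ1 K).𝔖).Pint j hh U ≤ cP) :
    Integrable ((h.dataT3cP hc γ hγ hγ1 π).up K j) (fieldMeasure (F.P K) j (Matrix.specialUnitaryGroup (Fin 2) ℂ)) := by
  have hmain : ∀ (hh : Hist (F.P K) j) (W : GaugeField (F.P K) j (Matrix.specialUnitaryGroup (Fin 2) ℂ)), (h.pkgAtV2 hc γ hγ hγ1 K).T.mainT j hh W =
      ((T3Scales F γ hγ (hγ1.trans (sq_min_one_le _ 𝔠.gamma0_pos)) K).gk j)⁻¹ ^ 2 *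
        (T3Scales F γ hγ (hγ1.trans (sq_min_one_le _ 𝔠.gamma0_pos)) K).actionEta j ((h.pkgAtV2 hc γ hγ hγ1 K).UkH j hh W) := fun _ _ => rfl
  have hfun : (h.dataT3cP hc γ hγ hγ1 π).up K j = fun W => ∑ r : Hist (F.P K) j, h.wtPT3 hc γ hγ hγ1 K j r W *
      Real.exp (-((h.pkgAtV2 hc γ hγ hγ1 K).T.mainT j r W) + (h.pkgAtV2 hc γ hγ hγ1 K).T.Pint j r W + (h.pkgAtV2 hc γ hγ hγ1 K).T.Zterm j r) :=
    funext fun W => h.dataT3cP_up_eq hc γ hγ hγ1 π K j W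
  rw [hfun]
  refine integrable_finsetSum _ fun hh _ => ?_
  refine integrable_mul_exp_of_le (h.integrable_wtPT3_and_integral_le hc γ hγ hγ1 K j hh).1 ?_ (c := cP + (h.pkgAtV2 hc γ hγ hγ1 K).T.Zterm j hh) ?_
  · simp_rw [hmain]
    exact ((measurable_const.mul ((Bound55Std.measurable_actionEta
      (S := T3Scales F γ hγ (hγ1.trans (sq_min_one_le _ 𝔠.gamma0_pos)) K) j).comp (hU hh))).neg.add (hPm hh)).add measurable_const
  · intro W
    have h0 : 0 ≤ (h.pkgAtV2 hc γ hγ hγ1 K).T.mainT j hh W := by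
      rw [hmain]
      exact mul_nonneg (sq_nonneg _) (Bound55Std.actionEta_nonneg (S := T3Scales F γ hγ (hγ1.trans (sq_min_one_le _ 𝔠.gamma0_pos)) K) j _)
    have h1 : (h.pkgAtV2 hc γ hγ hγ1 K).T.Pint j hh W ≤ cP := hPb hh W
    linarith

/-- **(iv) `up_{dataT3cP}` is integrable, every `j ≤ K`** (step rows below the top, terminal rows at the top). [folklore] -/
theorem AlphaInputsT3AC.OfV2At.dataT3cP_integrable_up (K j : ℕ) (hj : j ≤ K) :
    Integrable ((h.dataT3cP hc γ hγ hγ1 π).up K j) (fieldMeasure (F.P K) j (Matrix.specialUnitaryGroup (Fin 2) ℂ)) := by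
  rcases Nat.lt_or_eq_of_le hj with hlt | heq
  · have st := (h.pkgAtV2 hc γ hγ hγ1 K).run.steps j hlt
    exact h.integrable_upP_of_rows hc γ hγ hγ1 π K j st.hU st.hPm _ st.hPb
  · subst heq
    exact h.integrable_upP_of_rows hc γ hγ hγ1 π j j (h.pkgAtV2 hc γ hγ hγ1 j).terminal_measurable_UkH
      (h.pkgAtV2 hc γ hγ hγ1 j).terminal_measurable_Pint _ (h.pkgAtV2 hc γ hγ hγ1 j).terminal_Pint_le

end Weights

/-! ## §3 The bundle: v5p4's STUB 2‴ clauses, conditional on the v3 rows -/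

/-- **v5p4's `stub_windowedWeights` FOR THE CONCRETE v2 DATUM, GIVEN THE PROPOSED v3 RESIDUAL ROWS** — with `wt′ := OfV2At.wtPT3` (windowed PINNED weights)
and `Bm := 1`: for every block size, record and [7]-constants, every family with `F.L = L`, every package `OfV2At F 𝔠 a₀ a₁`, every coupling in the
package's window and all polymer fields, IF the rows `Fibre55WinRows` hold for the package's data, THEN (w0) `wt′ ≥ 0`; (w1) `wt′ = 0` on inadmissible
histories; (w2) for `1 ≤ j ≤ K` and EVERY history, POINTWISE, `wt′ K j r W ≠ 0 ⇒ Adm K j r W`; (e′) `Integrable (wt′ K j r) ∧ ∫ wt′ K j r ≤ 1` (all `K`, `j`, `r`);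
(e″) `Pint_j(r, ·)` measurable for `j ≤ K`; (iv) `Ineq41AE` and integrability of `up` for `dataT3c` with `LF` replaced as the stub writes it.  No coupling
threshold beyond the package's window is needed (the window sits in the row, not in an averaging lemma).  DIFFERENCES from the stub as registered: `1 ≤ j` in
(w2) (F-α1-9); the rows are an extra hypothesis (F-α1-10/11: not in the v2 package).  CONDITIONAL; nothing of [Balaban1985UV3] asserted.
[cite: Balaban1985UV3, (40)–(41) p.266, (47) p.267, (55) p.269 and Thm 2 p.272] -/
theorem AlphaInputsT3AC.windowedWeights_of_v3rows :
    ∀ (L : ℕ) (𝔠 : AlphaConsts L (suGroupModel 2).N) (a₀ a₁ : ℝ)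
      (F : T3Family) (hF : F.L = L) (h : AlphaInputsT3AC.OfV2At F (hF ▸ 𝔠) a₀ a₁)
      (hc : 0 < a₀ ∧ 0 < a₁ ∧ (hF ▸ 𝔠).B₃ * a₁ ≤ a₀) (γ : ℝ) (hγ : 0 < γ) (hγ1 : γ ≤ (min (hF ▸ 𝔠).gamma0 1) ^ 2)
      (π : AlphaInputsT3AC.PolymerT3 F), (∀ K, h.Fibre55WinRows hc γ hγ hγ1 K) →
      (∀ (K j : ℕ) (r : Hist (F.P K) j) (Wf : GaugeField (F.P K) j (Matrix.specialUnitaryGroup (Fin 2) ℂ)), 0 ≤ h.wtPT3 hc γ hγ hγ1 K j r Wf) ∧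
      (∀ (K j : ℕ) (r : Hist (F.P K) j) (Wf : GaugeField (F.P K) j (Matrix.specialUnitaryGroup (Fin 2) ℂ)),
        ¬ Hist.Admissible (hF ▸ 𝔠).lane.carrier.M₁
          (rcolOf (T3Scales F γ hγ (hγ1.trans (sq_min_one_le _ (hF ▸ 𝔠).gamma0_pos)) K) (hF ▸ 𝔠).lane.carrier) j r →
        h.wtPT3 hc γ hγ hγ1 K j r Wf = 0) ∧
      (∀ (K j : ℕ) (r : Hist (F.P K) j), 1 ≤ j → j ≤ K →
        ∀ Wf : GaugeField (F.P K) j (Matrix.specialUnitaryGroup (Fin 2) ℂ),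
          h.wtPT3 hc γ hγ hγ1 K j r Wf ≠ 0 → (h.dataT3c hc γ hγ hγ1 π).Adm K j r Wf) ∧
      (∀ (K j : ℕ) (r : Hist (F.P K) j),
        Integrable (h.wtPT3 hc γ hγ hγ1 K j r) (fieldMeasure (F.P K) j (Matrix.specialUnitaryGroup (Fin 2) ℂ)) ∧
        ∫ Wf, h.wtPT3 hc γ hγ hγ1 K j r Wf ∂fieldMeasure (F.P K) j (Matrix.specialUnitaryGroup (Fin 2) ℂ) ≤ 1) ∧
      (∀ (K j : ℕ) (r : Hist (F.P K) j), j ≤ K →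
        Measurable fun Wf : GaugeField (F.P K) j (Matrix.specialUnitaryGroup (Fin 2) ℂ) => (h.dataT3c hc γ hγ hγ1 π).Pint K j r Wf) ∧
      (∀ (K j : ℕ), j ≤ K →
        Ineq41AE ({ h.dataT3c hc γ hγ hγ1 π with
            LF := fun K j Wf Φ => h.wtPT3 hc γ hγ hγ1 K j (Hist.triv (F.P K) j) Wf * Real.exp (Φ (Hist.triv (F.P K) j)) +
              ∑ r ∈ Finset.univ.erase (Hist.triv (F.P K) j), h.wtPT3 hc γ hγ hγ1 K j r Wf * Real.exp (Φ r) } : AlphaDataT3 F γ) K j ∧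
        Integrable (AlphaDataT3.up ({ h.dataT3c hc γ hγ hγ1 π with
            LF := fun K j Wf Φ => h.wtPT3 hc γ hγ hγ1 K j (Hist.triv (F.P K) j) Wf * Real.exp (Φ (Hist.triv (F.P K) j)) +
              ∑ r ∈ Finset.univ.erase (Hist.triv (F.P K) j), h.wtPT3 hc γ hγ hγ1 K j r Wf * Real.exp (Φ r) } : AlphaDataT3 F γ) K j)
          (fieldMeasure (F.P K) j (Matrix.specialUnitaryGroup (Fin 2) ℂ))) := by
  intro L 𝔠 a₀ a₁ F hF
  subst hF
  intro h hc γ hγ hγ1 π hrows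
  exact ⟨fun K j r Wf => h.wtPT3_nonneg hc γ hγ hγ1 K j r Wf,
    fun K j r Wf hr => h.wtPT3_eq_zero_of_not_admissible hc γ hγ hγ1 K j r Wf hr,
    fun K j r hj1 hj Wf hW => h.adm_of_wtPT3_ne_zero hc γ hγ hγ1 π K j hj1 hj r Wf hW,
    fun K j r => h.integrable_wtPT3_and_integral_le hc γ hγ hγ1 K j r,
    fun K j r hj => h.dataT3c_measurable_Pint hc γ hγ hγ1 π K j hj r,
    fun K j hj => ⟨h.dataT3cP_ineq41AE hc γ hγ hγ1 π K (hrows K) j hj, h.dataT3cP_integrable_up hc γ hγ hγ1 π K j hj⟩⟩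

end Summit.QuantumFields.YangMills.Theorems

end
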